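import Mathlib
import HarnessLib
import Summits.HubbardSuperconductivity.HubbardSuperconductivity.Theorems.KLProgrammeKLRegimeCountertermJacksonLowPart

/-!
# Route `KLProgramme`, crux K3 — the Jackson mean in CONVOLUTION form: one-dimensional periodic convolution calculus (MS-A34-ter (K2), part 1)

Seat hubbard-kl-k3c3-p1 (g4).  The (E3a-MS) supplier chain needs the MIXED Jackson–Bernstein bound `‖Dʲ(𝒥_d g)‖ ≤ κ·(d+1)^{j−1}·‖∇g‖` for the low parts
of the deep pieces (the low-part totals `Λ₃, Λ₄` of `…TwoLegSizesMSWithPiecesL`): `j − 1` derivatives must fall on the KERNEL (each costing `(d+1)` in `L¹`)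
and ONE on `g`.  The tree's smoothing layer (`…CountertermJacksonFrameDeriv`, `jsmooth_package`) differentiates only the TRANSLATE `g(· − w)`; this
file supplies the complementary elementary calculus on `[−π, π]` for `2π`-periodic data:

* `hasDerivAt_intervalIntegral_of_continuous` — differentiation under `∫ t in a..b` from a jointly continuous partial derivative (the dominated
  lemma of Mathlib with the continuous bound on a compact neighbourhood);
* `periodic_integral_mul_comp_sub_comm` — `∫ k(s) g(x − s) = ∫ k(x − s) g(s)`; `periodic_integral_abs_comp_sub` — `∫ |φ(x − s)| = ∫ |φ|`;
* `periodic_integral_deriv_mul_eq` — integration by parts with vanishing boundary: `∫ φ′(x − s) H(s) = ∫ φ(x − s) H′(s)`;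
* `abs_integral_mul_le_of_abs_le` — `|∫ φ(x − s) ψ(s)| ≤ (∫|φ|)·sup|ψ|`;
* the CONVOLUTION FORM `convInt φ ψ h y := ∫ φ(y₀ − s) ∫ ψ(y₁ − t) h(s,t)` on `EuclideanSpace ℝ (Fin 2)`: `jsmooth_eq_convInt` (`𝒥_d g = convInt J̃ J̃ g`),
  directional derivatives along the coordinate axes add one derivative to the corresponding kernel factor (`hasDerivAt_convInt_fst/snd`),
  one kernel derivative trades for one derivative of `h` (`convInt_deriv_fst`, `convInt_deriv_snd`), and the sup bound `abs_convInt_le`.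

Pure real analysis; nothing about the model.  The mixed bound itself is assembled in `…CountertermJacksonMixedBernstein`.
-/

noncomputable section

namespace Summit.HubbardSuperconductivity.HubbardSuperconductivity.Theorems.KLRegimeSplit

set_option linter.dupNamespace false -- summit = problem name (single-conjunct summit), D-0017

open Real MeasureTheory intervalIntegral

/-! ## §1 One-dimensional periodic calculus on `[−π, π]` -/

/-- **Differentiation under the interval integral from a jointly continuous partial derivative.** -/
theorem hasDerivAt_intervalIntegral_of_continuous {F F' : ℝ → ℝ → ℝ} (hF : Continuous (Function.uncurry F))
    (hF' : Continuous (Function.uncurry F')) (hderiv : ∀ x t, HasDerivAt (fun x => F x t) (F' x t) x) (a b x₀ : ℝ) :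
    HasDerivAt (fun x => ∫ t in a..b, F x t) (∫ t in a..b, F' x₀ t) x₀ := by
  -- a uniform bound of `F'` on the compact `closedBall x₀ 1 × uIcc a b`
  obtain ⟨C, hC⟩ := (isCompact_closedBall x₀ (1 : ℝ)).prod (isCompact_uIcc (a := a) (b := b))
    |>.exists_bound_of_continuousOn hF'.continuousOn
  have hmeas : ∀ x, AEStronglyMeasurable (F x) (volume.restrict (Set.uIoc a b)) := fun x =>
    (hF.comp (Continuous.prodMk_right x)).aestronglyMeasurable
  refine (intervalIntegral.hasDerivAt_integral_of_dominated_loc_of_deriv_le (bound := fun _ => C)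
    (Metric.closedBall_mem_nhds x₀ zero_lt_one) (Filter.Eventually.of_forall hmeas)
    ((hF.comp (Continuous.prodMk_right x₀)).intervalIntegrable _ _)
    ((hF'.comp (Continuous.prodMk_right x₀)).aestronglyMeasurable)
    (Filter.Eventually.of_forall fun t ht x hx => ?_) intervalIntegrable_const
    (Filter.Eventually.of_forall fun t _ x _ => hderiv x t)).2
  have ht' : t ∈ Set.uIcc a b := Set.uIoc_subset_uIcc ht
  exact hC (x, t) ⟨hx, ht'⟩

/-- **Commuting a periodic convolution**: `∫ k(s) g(x − s) ds = ∫ k(x − s) g(s) ds` over a period, for `2π`-periodic `k`, `g`. -/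
theorem periodic_integral_mul_comp_sub_comm {k g : ℝ → ℝ} (hk : Function.Periodic k (2 * π)) (hg : Function.Periodic g (2 * π)) (x : ℝ) :
    ∫ s in (-π)..π, k s * g (x - s) = ∫ s in (-π)..π, k (x - s) * g s := by
  have hper : Function.Periodic (fun u => k (x - u) * g u) (2 * π) := by
    intro u
    simp only
    rw [show x - (u + 2 * π) = (x - u) - 2 * π by ring, hk.sub_eq, hg u]
  have h := integral_comp_sub_of_periodic hper x
  simp only [sub_sub_cancel] at h
  exact h

/-- **The `L¹` mass of a shifted reflected periodic function**: `∫ |φ(x − s)| ds = ∫ |φ(s)| ds`. -/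
theorem periodic_integral_abs_comp_sub {φ : ℝ → ℝ} (hφ : Function.Periodic φ (2 * π)) (x : ℝ) :
    ∫ s in (-π)..π, |φ (x - s)| = ∫ s in (-π)..π, |φ s| :=
  integral_comp_sub_of_periodic (g := fun s => |φ s|) (fun s => by simp only; rw [hφ s]) x

/-- **Periodic integration by parts** (boundary terms cancel): `∫ φ′(x − s) H(s) ds = ∫ φ(x − s) H′(s) ds`. -/
theorem periodic_integral_deriv_mul_eq {φ φ' H H' : ℝ → ℝ} (hφ : ∀ s, HasDerivAt φ (φ' s) s) (hH : ∀ s, HasDerivAt H (H' s) s)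
    (hφ'c : Continuous φ') (hH'c : Continuous H') (hφper : Function.Periodic φ (2 * π)) (hHper : Function.Periodic H (2 * π))
    (x : ℝ) : ∫ s in (-π)..π, φ' (x - s) * H s = ∫ s in (-π)..π, φ (x - s) * H' s := by
  -- `u s := φ (x − s)`, `u' s = −φ'(x − s)`
  have hu : ∀ s ∈ Set.uIcc (-π) π, HasDerivAt (fun s => φ (x - s)) (-φ' (x - s)) s :=
    fun s _ => (hφ (x - s)).comp_const_sub x s
  have hv : ∀ s ∈ Set.uIcc (-π) π, HasDerivAt H (H' s) s := fun s _ => hH s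
  have hu' : IntervalIntegrable (fun s => -φ' (x - s)) volume (-π) π :=
    ((hφ'c.comp (continuous_const.sub continuous_id)).neg).intervalIntegrable _ _
  have hv' : IntervalIntegrable H' volume (-π) π := hH'c.intervalIntegrable _ _
  have hparts := intervalIntegral.integral_mul_deriv_eq_deriv_mul hu hv hu' hv'
  -- boundary terms: `φ(x − π) H(π) − φ(x + π) H(−π) = 0`
  have hb : φ (x - π) * H π - φ (x - -π) * H (-π) = 0 := by
    rw [show x - -π = (x - π) + 2 * π by ring, hφper, show π = -π + 2 * π by ring, hHper]
    ring
  have hneg : ∫ s in (-π)..π, -φ' (x - s) * H s = -∫ s in (-π)..π, φ' (x - s) * H s := by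
    rw [← intervalIntegral.integral_neg]; congr 1; funext s; ring
  rw [hb, hneg] at hparts
  linarith

/-- **Sup bound of a periodic convolution**: `|∫ φ(x − s) ψ(s) ds| ≤ (∫ |φ|)·B` when `|ψ| ≤ B`. -/
theorem abs_integral_mul_le_of_abs_le {φ ψ : ℝ → ℝ} (hφc : Continuous φ) (hψc : Continuous ψ) (hφ : Function.Periodic φ (2 * π))
    {B : ℝ} (hB : ∀ s, |ψ s| ≤ B) (x : ℝ) :
    |∫ s in (-π)..π, φ (x - s) * ψ s| ≤ (∫ s in (-π)..π, |φ s|) * B := by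
  have hππ : -π ≤ π := by linarith [Real.pi_pos]
  have hB0 : 0 ≤ B := (abs_nonneg _).trans (hB 0)
  calc |∫ s in (-π)..π, φ (x - s) * ψ s| ≤ ∫ s in (-π)..π, |φ (x - s) * ψ s| :=
        intervalIntegral.abs_integral_le_integral_abs hππ
    _ ≤ ∫ s in (-π)..π, |φ (x - s)| * B := by
        refine intervalIntegral.integral_mono_on hππ ?_ ?_ fun s _ => ?_
        · exact ((hφc.comp (continuous_const.sub continuous_id)).mul hψc).abs.intervalIntegrable _ _
        · exact ((hφc.comp (continuous_const.sub continuous_id)).abs.mul continuous_const).intervalIntegrable _ _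
        · rw [abs_mul]; exact mul_le_mul_of_nonneg_left (hB s) (abs_nonneg _)
    _ = (∫ s in (-π)..π, |φ s|) * B := by
        rw [intervalIntegral.integral_mul_const, periodic_integral_abs_comp_sub hφ]

/-! ## §2 The convolution form of the Jackson mean on `EuclideanSpace ℝ (Fin 2)` -/

/-- Periodicity in each coordinate, from the tree's lattice-periodicity hypothesis. -/
theorem periodic_fst_of_lattice {h : (Fin 2 → ℝ) → ℝ} (hper : ∀ (p : Fin 2 → ℝ) (z : Fin 2 → ℤ), h (fun i => p i + z i * (2 * π)) = h p)
    (t : ℝ) : Function.Periodic (fun s => h ![s, t]) (2 * π) := fun s => symm_add_two_pi_fst hper s t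

/-- Periodicity in the second coordinate. -/
theorem periodic_snd_of_lattice {h : (Fin 2 → ℝ) → ℝ} (hper : ∀ (p : Fin 2 → ℝ) (z : Fin 2 → ℤ), h (fun i => p i + z i * (2 * π)) = h p)
    (s : ℝ) : Function.Periodic (fun t => h ![s, t]) (2 * π) := fun t => symm_add_two_pi_snd hper s t

/-- **The convolution form**: `convInt φ ψ h y = ∫ φ(y₀ − s) (∫ ψ(y₁ − t) h(s,t) dt) ds` over `[−π, π]²`. -/
def convInt (φ ψ : ℝ → ℝ) (h : (Fin 2 → ℝ) → ℝ) (y : EuclideanSpace ℝ (Fin 2)) : ℝ :=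
  ∫ s in (-π)..π, φ (y 0 - s) * ∫ t in (-π)..π, ψ (y 1 - t) * h ![s, t]

/-- `h ![s, t]` is jointly continuous for continuous `h`. -/
theorem continuous_vec2 {h : (Fin 2 → ℝ) → ℝ} (hh : Continuous h) : Continuous fun w : ℝ × ℝ => h ![w.1, w.2] := by
  refine hh.comp ?_
  refine continuous_pi fun i => ?_
  fin_cases i
  · simpa using continuous_fst
  · simpa using continuous_snd

section Conv

variable {φ ψ : ℝ → ℝ} {h : (Fin 2 → ℝ) → ℝ}

/-- The inner integral `(u, s) ↦ ∫ ψ(u − t) h(s, t) dt` is jointly continuous. -/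
theorem continuous_inner_conv (hψ : Continuous ψ) (hh : Continuous h) :
    Continuous fun p : ℝ × ℝ => ∫ t in (-π)..π, ψ (p.1 - t) * h ![p.2, t] := by
  have hc : Continuous (Function.uncurry fun (p : ℝ × ℝ) (t : ℝ) => ψ (p.1 - t) * h ![p.2, t]) := by
    refine Continuous.mul ?_ ?_
    · exact hψ.comp ((continuous_fst.comp continuous_fst).sub continuous_snd)
    · exact (continuous_vec2 hh).comp ((continuous_snd.comp continuous_fst).prodMk continuous_snd)
  exact intervalIntegral.continuous_parametric_intervalIntegral_of_continuous' hc _ _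

/-- **`𝒥_d g` in convolution form**: `jsmooth d g (ofLp y) = convInt J̃_d J̃_d g y` for `2π`-lattice-periodic `g`. -/
theorem jsmooth_eq_convInt (d : ℕ) (hper : ∀ (p : Fin 2 → ℝ) (z : Fin 2 → ℤ), h (fun i => p i + z i * (2 * π)) = h p)
    (y : EuclideanSpace ℝ (Fin 2)) : jsmooth d h (WithLp.ofLp y) = convInt (jker d) (jker d) h y := by
  unfold jsmooth convInt
  -- inner variable
  have hinner : ∀ s, ∫ t in (-π)..π, jker d s * jker d t * h ![WithLp.ofLp y 0 - s, WithLp.ofLp y 1 - t] =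
      jker d s * ∫ t in (-π)..π, jker d (y 1 - t) * h ![y 0 - s, t] := by
    intro s
    have h1 : ∫ t in (-π)..π, jker d s * jker d t * h ![WithLp.ofLp y 0 - s, WithLp.ofLp y 1 - t] =
        jker d s * ∫ t in (-π)..π, jker d t * h ![y 0 - s, y 1 - t] := by
      rw [← intervalIntegral.integral_const_mul]
      congr 1; funext t; ring
    rw [h1, periodic_integral_mul_comp_sub_comm (jker_periodic d) (periodic_snd_of_lattice hper (y 0 - s)) (y 1)]
  simp_rw [hinner]
  -- outer variable: `s ↦ ∫ J̃(y₁ − t) h(s, t) dt` is `2π`-periodic in `s`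
  have hG : Function.Periodic (fun u => ∫ t in (-π)..π, jker d (y 1 - t) * h ![u, t]) (2 * π) := by
    intro u
    simp only
    congr 1; funext t; rw [symm_add_two_pi_fst hper u t]
  exact periodic_integral_mul_comp_sub_comm (jker_periodic d) hG (y 0)

/-- The standard basis vectors of `EuclideanSpace ℝ (Fin 2)`. -/
abbrev eucl (i : Fin 2) : EuclideanSpace ℝ (Fin 2) := EuclideanSpace.single i 1

/-- Coordinates of `y + τ • e₀`. -/
theorem add_smul_eucl_zero_apply (y : EuclideanSpace ℝ (Fin 2)) (τ : ℝ) :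
    (y + τ • eucl 0) 0 = y 0 + τ ∧ (y + τ • eucl 0) 1 = y 1 := by
  constructor <;> simp [eucl]

/-- Coordinates of `y + τ • e₁`. -/
theorem add_smul_eucl_one_apply (y : EuclideanSpace ℝ (Fin 2)) (τ : ℝ) :
    (y + τ • eucl 1) 0 = y 0 ∧ (y + τ • eucl 1) 1 = y 1 + τ := by
  constructor <;> simp [eucl]

/-- **Directional derivative along `e₀`**: one more derivative on the FIRST kernel factor. -/
theorem hasDerivAt_convInt_fst {φ' : ℝ → ℝ} (hφ : ∀ s, HasDerivAt φ (φ' s) s) (hφc : Continuous φ) (hφ'c : Continuous φ')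
    (hψ : Continuous ψ) (hh : Continuous h) (y : EuclideanSpace ℝ (Fin 2)) :
    HasDerivAt (fun τ : ℝ => convInt φ ψ h (y + τ • eucl 0)) (convInt φ' ψ h y) (0 : ℝ) := by
  have hcoord : ∀ τ : ℝ, convInt φ ψ h (y + τ • eucl 0) =
      ∫ s in (-π)..π, φ (y 0 + τ - s) * ∫ t in (-π)..π, ψ (y 1 - t) * h ![s, t] := by
    intro τ; unfold convInt
    rw [(add_smul_eucl_zero_apply y τ).1, (add_smul_eucl_zero_apply y τ).2]
  simp_rw [hcoord]
  unfold convInt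
  set G : ℝ → ℝ := fun s => ∫ t in (-π)..π, ψ (y 1 - t) * h ![s, t] with hGdef
  have hGc : Continuous G := (continuous_inner_conv hψ hh).comp (continuous_const.prodMk continuous_id)
  have h := hasDerivAt_intervalIntegral_of_continuous (F := fun τ s => φ (y 0 + τ - s) * G s)
    (F' := fun τ s => φ' (y 0 + τ - s) * G s) ?_ ?_ ?_ (-π) π 0
  · simpa using h
  · exact (hφc.comp ((continuous_const.add continuous_fst).sub continuous_snd)).mul (hGc.comp continuous_snd)
  · exact (hφ'c.comp ((continuous_const.add continuous_fst).sub continuous_snd)).mul (hGc.comp continuous_snd)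
  · intro τ s
    have h1 := (hφ (y 0 + τ - s)).comp τ (((hasDerivAt_id τ).const_add (y 0)).sub_const s)
    simp only [Function.comp_def, mul_one] at h1
    simpa using h1.mul_const (G s)

/-- **Directional derivative along `e₁`**: one more derivative on the SECOND kernel factor. -/
theorem hasDerivAt_convInt_snd {ψ' : ℝ → ℝ} (hψ : ∀ t, HasDerivAt ψ (ψ' t) t) (hψc : Continuous ψ) (hψ'c : Continuous ψ')
    (hφ : Continuous φ) (hh : Continuous h) (y : EuclideanSpace ℝ (Fin 2)) :
    HasDerivAt (fun τ : ℝ => convInt φ ψ h (y + τ • eucl 1)) (convInt φ ψ' h y) (0 : ℝ) := by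
  have hcoord : ∀ τ : ℝ, convInt φ ψ h (y + τ • eucl 1) =
      ∫ s in (-π)..π, φ (y 0 - s) * ∫ t in (-π)..π, ψ (y 1 + τ - t) * h ![s, t] := by
    intro τ; unfold convInt
    rw [(add_smul_eucl_one_apply y τ).1, (add_smul_eucl_one_apply y τ).2]
  simp_rw [hcoord]
  unfold convInt
  -- the inner integral as a function of `(τ, s)` and its `τ`-derivative
  set I : ℝ → ℝ → ℝ := fun τ s => ∫ t in (-π)..π, ψ (y 1 + τ - t) * h ![s, t] with hIdef
  set I' : ℝ → ℝ → ℝ := fun τ s => ∫ t in (-π)..π, ψ' (y 1 + τ - t) * h ![s, t] with hI'def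
  have hIc : Continuous (Function.uncurry I) :=
    (continuous_inner_conv hψc hh).comp ((continuous_const.add continuous_fst).prodMk continuous_snd)
  have hI'c : Continuous (Function.uncurry I') :=
    (continuous_inner_conv hψ'c hh).comp ((continuous_const.add continuous_fst).prodMk continuous_snd)
  have hIderiv : ∀ τ s, HasDerivAt (fun τ => I τ s) (I' τ s) τ := by
    intro τ s
    have h := hasDerivAt_intervalIntegral_of_continuous (F := fun τ t => ψ (y 1 + τ - t) * h ![s, t])
      (F' := fun τ t => ψ' (y 1 + τ - t) * h ![s, t]) ?_ ?_ ?_ (-π) π τ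
    · exact h
    · exact (hψc.comp ((continuous_const.add continuous_fst).sub continuous_snd)).mul
        ((continuous_vec2 hh).comp (continuous_const.prodMk continuous_snd))
    · exact (hψ'c.comp ((continuous_const.add continuous_fst).sub continuous_snd)).mul
        ((continuous_vec2 hh).comp (continuous_const.prodMk continuous_snd))
    · intro τ' t
      have h1 := (hψ (y 1 + τ' - t)).comp τ' (((hasDerivAt_id τ').const_add (y 1)).sub_const t)
      simp only [Function.comp_def, mul_one] at h1
      simpa using h1.mul_const (h ![s, t])
  have h := hasDerivAt_intervalIntegral_of_continuous (F := fun τ s => φ (y 0 - s) * I τ s)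
    (F' := fun τ s => φ (y 0 - s) * I' τ s) ?_ ?_ ?_ (-π) π 0
  · simpa [hIdef, hI'def] using h
  · exact (hφ.comp (continuous_const.sub continuous_snd)).mul hIc
  · exact (hφ.comp (continuous_const.sub continuous_snd)).mul hI'c
  · intro τ s; exact (hIderiv τ s).const_mul _

/-- **Trading a kernel derivative for a derivative of `h` in the FIRST coordinate** (integration by parts in `s`). -/
theorem convInt_deriv_fst {φ' : ℝ → ℝ} {h₀ : (Fin 2 → ℝ) → ℝ} (hφ : ∀ s, HasDerivAt φ (φ' s) s) (hφ'c : Continuous φ')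
    (hφper : Function.Periodic φ (2 * π)) (hψ : Continuous ψ) (hh : Continuous h) (hh₀ : Continuous h₀)
    (hder : ∀ s t, HasDerivAt (fun u => h ![u, t]) (h₀ ![s, t]) s)
    (hper : ∀ (p : Fin 2 → ℝ) (z : Fin 2 → ℤ), h (fun i => p i + z i * (2 * π)) = h p) (y : EuclideanSpace ℝ (Fin 2)) :
    convInt φ' ψ h y = convInt φ ψ h₀ y := by
  unfold convInt
  set H : ℝ → ℝ := fun s => ∫ t in (-π)..π, ψ (y 1 - t) * h ![s, t] with hHdef
  set H' : ℝ → ℝ := fun s => ∫ t in (-π)..π, ψ (y 1 - t) * h₀ ![s, t] with hH'def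
  have hHd : ∀ s, HasDerivAt H (H' s) s := by
    intro s
    exact hasDerivAt_intervalIntegral_of_continuous (F := fun s t => ψ (y 1 - t) * h ![s, t])
      (F' := fun s t => ψ (y 1 - t) * h₀ ![s, t])
      ((hψ.comp (continuous_const.sub continuous_snd)).mul (continuous_vec2 hh))
      ((hψ.comp (continuous_const.sub continuous_snd)).mul (continuous_vec2 hh₀))
      (fun s t => (hder s t).const_mul _) (-π) π s
  have hH'c : Continuous H' := (continuous_inner_conv hψ hh₀).comp (continuous_const.prodMk continuous_id)
  have hHper : Function.Periodic H (2 * π) := by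
    intro u; simp only [hHdef]; congr 1; funext t; rw [symm_add_two_pi_fst hper u t]
  exact periodic_integral_deriv_mul_eq hφ hHd hφ'c hH'c hφper hHper (y 0)

/-- **Trading a kernel derivative for a derivative of `h` in the SECOND coordinate** (integration by parts in `t`). -/
theorem convInt_deriv_snd {ψ' : ℝ → ℝ} {h₁ : (Fin 2 → ℝ) → ℝ} (hψ : ∀ t, HasDerivAt ψ (ψ' t) t) (hψ'c : Continuous ψ')
    (hψper : Function.Periodic ψ (2 * π)) (hh₁ : Continuous h₁)
    (hder : ∀ s t, HasDerivAt (fun u => h ![s, u]) (h₁ ![s, t]) t)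
    (hper : ∀ (p : Fin 2 → ℝ) (z : Fin 2 → ℤ), h (fun i => p i + z i * (2 * π)) = h p) (y : EuclideanSpace ℝ (Fin 2)) :
    convInt φ ψ' h y = convInt φ ψ h₁ y := by
  unfold convInt
  congr 1; funext s; congr 1
  exact periodic_integral_deriv_mul_eq hψ (fun t => hder s t) hψ'c ((continuous_vec2 hh₁).comp (continuous_const.prodMk continuous_id))
    hψper (periodic_snd_of_lattice hper s) (y 1)

/-- **Sup bound of the convolution form**: `|convInt φ ψ h y| ≤ (∫|φ|)(∫|ψ|)·sup|h|`. -/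
theorem abs_convInt_le (hφc : Continuous φ) (hψc : Continuous ψ) (hφ : Function.Periodic φ (2 * π))
    (hψ : Function.Periodic ψ (2 * π)) (hh : Continuous h) {B : ℝ} (hB : ∀ p, |h p| ≤ B) (y : EuclideanSpace ℝ (Fin 2)) :
    |convInt φ ψ h y| ≤ (∫ s in (-π)..π, |φ s|) * ((∫ t in (-π)..π, |ψ t|) * B) := by
  unfold convInt
  refine abs_integral_mul_le_of_abs_le hφc ((continuous_inner_conv hψc hh).comp (continuous_const.prodMk continuous_id)) hφ
    (fun s => ?_) (y 0)
  exact abs_integral_mul_le_of_abs_le hψc ((continuous_vec2 hh).comp (continuous_const.prodMk continuous_id)) hψ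
    (fun t => hB _) (y 1)

end Conv

end Summit.HubbardSuperconductivity.HubbardSuperconductivity.Theorems.KLRegimeSplit

end
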